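import Summits.MatrixMultiplication.OmegaCensus.CubeLawParity
import Summits.MatrixMultiplication.OmegaCensus.NearTilingPeriodic
import Summits.MatrixMultiplication.OmegaCensus.C2QuaternionLawModSixFour
import HarnessLib

/-!
# No `law − 4` triple of shape P5 in dicyclic-type groups; `β(C₂ × Q_{4m})` off one residue

ω-census, family (b3).  Framing: lottery ticket; floor = certified bounds/negative ranges.

Dihedral-like `G(A, c₀)` with `c₀ ≠ 0` (dicyclic type), `|A| ≡ 1 (mod 3)`.  By `VertexCountingSubFourShape.lean` a TPP
triple of volume `law − 4 = (8|A| − 20)/3` has one of the part shapes P1, P3, P5; P1 forces `A/⟨c₀⟩` cyclic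
(`DihedralLikeLawGap12.lean`).  **Here: P5 never occurs in dicyclic type** (`no_sub_four_P5_of_c0_ne_zero`).

**Proof.** Shape `(c+1, c | 1,1 | 5,5)` (big `ρ`-part; the other orientation is reduced to this one by the right
translation `S ↦ S·τ0`), `T₀ = {t}`, `T₁ = {b}`, `|A| = 15c + 10`.  The vertex-`000` boxes `S₁+t+U₀`, `S₀+b+U₀`,
`S₀+t+U₁` have total size `5c + 5(c+1) + 5(c+1) = |A|`: they TILE `A` (slack `0`).  The same vertex of the
`T`-translate `(S, T·τ0, U)` (parts `T₀' = {−c₀−b}`, `T₁' = {−t}`) tiles `A` by `S₁−c₀−b+U₀`, `S₀−t+U₀`, `S₀−c₀−b+U₁`: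
the two outer tiles are the old ones shifted by `d = −c₀−b−t`, hence so is the middle one (`shift_of_two_tilings`):
`S₀+U₀−t = S₀+U₀+b+d = S₀+U₀−c₀−t`, i.e. `S₀ + b + U₀` is `c₀`-PERIODIC, so `5(c+1)` is even (`card_even_of_periodic`);
but `|A| = 15c + 10` is even (`c₀` has order `2`), so `c` is even — contradiction.  No characters are needed.

**Consequences.** `sub_four_shape_of_quot_noncyclic_P3` / `card_mod_nine_of_sub_four_quot_noncyclic`: for `A/⟨c₀⟩`
non-cyclic (`|A| ≥ 52`) a `law − 4` triple has shape P3 `(c+1, c | 1,1 | 3,3)` and `|A| ≡ 7 (mod 9)`;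
`tpp_volume_dicyclic_quot_noncyclic'`.  For `C₂ × Q_{4m}`,
`m ≡ 4 (mod 6)`, `m ≥ 13`: **`β(C₂ × Q_{4m}) = 16⌊2m/3⌋` exactly unless `m ≡ 4 (mod 9)`**
(`c2_quaternion_law_mod_six_four'`; the residue `m ≡ 10 (mod 15)` of `C2QuaternionLawModSixFour.lean` is gone), i.e. for
`m ≡ 10, 16 (mod 18)`; the remaining class `m ≡ 4 (mod 18)` (`m = 22, 40, 58, …`) has `β ∈ {law − 8, law − 4}` with
`law − 4` only through P3.
-/

namespace Summit.MatrixMultiplication.OmegaCensus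

open Literature.Combinatorics.Additive Finset

section Shift

variable {A : Type*} [AddCommGroup A] [DecidableEq A]

/-- Translating the middle singleton of a threefold sumset translates the sumset. [folklore] -/
theorem sumset₃_singleton_shift (X Z : Finset A) (y y' : A) :
    ((X ×ˢ ({y} : Finset A) ×ˢ Z).image fun p : A × A × A => p.1 + p.2.1 + p.2.2) =
      (((X ×ˢ ({y'} : Finset A) ×ˢ Z).image fun p : A × A × A => p.1 + p.2.1 + p.2.2)).image (· + (y - y')) := by
  ext x
  simp only [mem_image, mem_product, mem_singleton, Prod.exists]
  constructor
  · rintro ⟨a, b, c, ⟨ha, rfl, hc⟩, rfl⟩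
    exact ⟨a + y' + c, ⟨a, y', c, ⟨ha, rfl, hc⟩, rfl⟩, by abel⟩
  · rintro ⟨w, ⟨a, b, c, ⟨ha, rfl, hc⟩, rfl⟩, rfl⟩
    exact ⟨a, y, c, ⟨ha, rfl, hc⟩, by abel⟩

/-- If `Q + d = Q + e` then `Q` is `(d − e)`-periodic. [folklore] -/
theorem image_add_periodic_of_eq {Q : Finset A} {d e : A} (h : Q.image (· + d) = Q.image (· + e)) :
    Q.image (· + (d - e)) = Q := by
  ext x
  simp only [mem_image]
  constructor
  · rintro ⟨q, hq, rfl⟩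
    have hmem : q + d ∈ Q.image (· + e) := h ▸ mem_image_of_mem _ hq
    obtain ⟨q', hq', hqq'⟩ := mem_image.1 hmem
    rw [show q + (d - e) = q + d - e by abel, ← eq_sub_of_add_eq hqq']
    exact hq'
  · intro hx
    have hmem : x + e ∈ Q.image (· + d) := h.symm ▸ mem_image_of_mem _ hx
    obtain ⟨q, hq, hqx⟩ := mem_image.1 hmem
    exact ⟨q, hq, by rw [show q + (d - e) = q + d - e by abel, hqx]; abel⟩

variable [Fintype A]

/-- **Two tilings sharing two shifted tiles share the third.** `P ⊔ Q ⊔ R` and `P' ⊔ Q' ⊔ R'` both of total size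
`|A|` (pairwise disjoint), `P' = P + d`, `R' = R + d`, `|Q'| = |Q|`: then `Q' = Q + d`. [folklore] -/
theorem shift_of_two_tilings {P Q R P' Q' R' : Finset A} (d : A) (hPQ : Disjoint P Q) (hQR : Disjoint Q R)
    (hP'Q' : Disjoint P' Q') (hP'R' : Disjoint P' R') (hQ'R' : Disjoint Q' R')
    (hcard' : P'.card + Q'.card + R'.card = Fintype.card A)
    (hP' : P' = P.image (· + d)) (hR' : R' = R.image (· + d)) (hQQ' : Q'.card = Q.card) :
    Q' = Q.image (· + d) := by
  have huniv : P' ∪ Q' ∪ R' = univ := eq_univ_of_card _ (by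
    rw [card_union_of_disjoint (disjoint_union_left.2 ⟨hP'R', hQ'R'⟩), card_union_of_disjoint hP'Q', hcard'])
  symm
  apply eq_of_subset_of_card_le
  · intro x hx
    obtain ⟨q, hq, rfl⟩ := mem_image.1 hx
    have hmem : q + d ∈ P' ∪ Q' ∪ R' := huniv ▸ mem_univ _
    rcases mem_union.1 hmem with h1 | h1
    · rcases mem_union.1 h1 with h2 | h2
      · rw [hP'] at h2
        obtain ⟨p, hp, hpq⟩ := mem_image.1 h2
        have : p = q := add_right_cancel hpq
        subst this
        exact absurd hq (disjoint_left.1 hPQ hp)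
      · exact h2
    · rw [hR'] at h1
      obtain ⟨r, hr, hrq⟩ := mem_image.1 h1
      have : r = q := add_right_cancel hrq
      subst this
      exact absurd hq (disjoint_right.1 hQR hr)
  · rw [card_image_of_injective _ (add_left_injective d), hQQ']

end Shift

section DihedralLike

variable {A : Type*} [AddCommGroup A] [DecidableEq A] [Fintype A] {G : Type} [Group G] [DecidableEq G]
  {ρ τ : A → G} {c₀ : A} {S T U : Finset G}

/-- Core of the P5 exclusion (orientation: the `ρ`-part of `S` is the larger one).  Dicyclic type `c₀ ≠ 0`; a TPP
triple with parts `(s₁+1, s₁ | 1,1 | 5,5)` and `3|S||T||U| + 20 = 8|A|` does not exist. [folklore] -/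
theorem no_sub_four_P5_core
    (hρρ : ∀ a b, ρ a * ρ b = ρ (a + b)) (hρτ : ∀ a b, ρ a * τ b = τ (b - a))
    (hτρ : ∀ a b, τ a * ρ b = τ (a + b)) (hττ : ∀ a b, τ a * τ b = ρ (c₀ + b - a)) (hc₀ : c₀ ≠ 0)
    (hρ : Function.Injective ρ) (hτ : Function.Injective τ) (hne : ∀ a b, ρ a ≠ τ b)
    (hsurj : ∀ g, (∃ a, ρ a = g) ∨ (∃ a, τ a = g)) (h : TripleProductProperty S T U)
    (hs : (univ.filter fun a : A => ρ a ∈ S).card = (univ.filter fun a : A => τ a ∈ S).card + 1)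
    (ht₀ : (univ.filter fun a : A => ρ a ∈ T).card = 1) (ht₁ : (univ.filter fun a : A => τ a ∈ T).card = 1)
    (hu₀ : (univ.filter fun a : A => ρ a ∈ U).card = 5) (hu₁ : (univ.filter fun a : A => τ a ∈ U).card = 5)
    (hV : 3 * (S.card * T.card * U.card) + 20 = 8 * Fintype.card A) : False := by
  set S₀ : Finset A := univ.filter fun a => ρ a ∈ S with hS₀
  set S₁ : Finset A := univ.filter fun a => τ a ∈ S with hS₁
  set T₀ : Finset A := univ.filter fun a => ρ a ∈ T with hT₀
  set T₁ : Finset A := univ.filter fun a => τ a ∈ T with hT₁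
  set U₀ : Finset A := univ.filter fun a => ρ a ∈ U with hU₀
  set U₁ : Finset A := univ.filter fun a => τ a ∈ U with hU₁
  have h2c := two_c0_eq_zero hρτ hτρ hττ hτ
  -- numerics: `|A| = 15 s₁ + 10` is even
  have cS : S.card = S₀.card + S₁.card := card_eq_parts' hρ hτ hne hsurj S
  have cT : T.card = T₀.card + T₁.card := card_eq_parts' hρ hτ hne hsurj T
  have cU : U.card = U₀.card + U₁.card := card_eq_parts' hρ hτ hne hsurj U
  rw [cS, cT, cU, hs, ht₀, ht₁, hu₀, hu₁] at hV
  have hNeven : 2 ∣ Fintype.card A := by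
    have ho : addOrderOf c₀ = 2 := addOrderOf_eq_prime (by rw [two_nsmul, h2c]) hc₀
    rw [← ho]; exact addOrderOf_dvd_card
  -- the singletons
  obtain ⟨t, hT₀t⟩ := card_eq_one.1 ht₀
  obtain ⟨b, hT₁b⟩ := card_eq_one.1 ht₁
  -- membership facts
  have mS₀ : ∀ a ∈ S₀, cond false (τ a) (ρ a) ∈ S := fun a ha => by simpa [hS₀] using ha
  have mS₁ : ∀ a ∈ S₁, cond true (τ a) (ρ a) ∈ S := fun a ha => by simpa [hS₁] using ha
  have mT₀ : ∀ a ∈ T₀, cond false (τ a) (ρ a) ∈ T := fun a ha => by simpa [hT₀] using ha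
  have mT₁ : ∀ a ∈ T₁, cond true (τ a) (ρ a) ∈ T := fun a ha => by simpa [hT₁] using ha
  have mU₀ : ∀ a ∈ U₀, cond false (τ a) (ρ a) ∈ U := fun a ha => by simpa [hU₀] using ha
  have mU₁ : ∀ a ∈ U₁, cond true (τ a) (ρ a) ∈ U := fun a ha => by simpa [hU₁] using ha
  -- vertex 000 of `(S, T, U)`: a tiling `P ⊔ Q ⊔ R = A`
  have cs := card_sumset' hρρ hττ hρ hτ h
  have d₁ := disjoint_sumset₁' hρρ hρτ hτρ hττ hne h
  have d₂ := disjoint_sumset₂' hρρ hρτ hτρ hττ hne h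
  have d₃ := disjoint_sumset₃' hρρ hρτ hτρ hττ hne h
  have hPQ := d₁ false mS₁ mT₀ mU₀ mS₀ mT₁
  have hQR := d₂ false mS₀ mT₁ mU₀ mS₀ mT₀ mU₁
  -- the `T`-translate `(S, T·τ0, U)` and its vertex 000: a tiling `P' ⊔ Q' ⊔ R' = A`
  have er : (Equiv.mulRight (1 : G)).toEmbedding = Function.Embedding.refl G := by ext x; simp
  have hT' := h.map_mulRight 1 (τ 0) 1
  simp only [er, Finset.map_refl] at hT'
  set T' := T.map (Equiv.mulRight (τ 0)).toEmbedding with hT'def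
  set T₀' : Finset A := univ.filter fun a => ρ a ∈ T' with hT₀'
  set T₁' : Finset A := univ.filter fun a => τ a ∈ T' with hT₁'
  have eT₀' : T₀' = {-c₀ - b} := by
    rw [hT₀', hT'def, rho_part_mulRight_tau hρρ hρτ hττ, ← hT₁, hT₁b, image_singleton]
  have eT₁' : T₁' = {-t} := by
    rw [hT₁', hT'def, tau_part_mulRight_tau hρρ hττ, ← hT₀, hT₀t, image_singleton]
  have mT₀' : ∀ a ∈ T₀', cond false (τ a) (ρ a) ∈ T' := fun a ha => by simpa [hT₀'] using ha
  have mT₁' : ∀ a ∈ T₁', cond true (τ a) (ρ a) ∈ T' := fun a ha => by simpa [hT₁'] using ha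
  have cs' := card_sumset' hρρ hττ hρ hτ hT'
  have d₁' := disjoint_sumset₁' hρρ hρτ hτρ hττ hne hT'
  have d₂' := disjoint_sumset₂' hρρ hρτ hτρ hττ hne hT'
  have d₃' := disjoint_sumset₃' hρρ hρτ hτρ hττ hne hT'
  have hP'Q' := d₁' false mS₁ mT₀' mU₀ mS₀ mT₁'
  have hP'R' := (d₃' false mS₀ mT₀' mU₁ mS₁ mU₀).symm
  have hQ'R' := d₂' false mS₀ mT₁' mU₀ mS₀ mT₀' mU₁
  -- sizes
  have cP' := cs' true false false mS₁ mT₀' mU₀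
  have cQ' := cs' false true false mS₀ mT₁' mU₀
  have cR' := cs' false false true mS₀ mT₀' mU₁
  have cQ := cs false true false mS₀ mT₁ mU₀
  have cT₀' : T₀'.card = 1 := by rw [eT₀', card_singleton]
  have cT₁' : T₁'.card = 1 := by rw [eT₁', card_singleton]
  -- the shift relations
  have hP' : ((S₁ ×ˢ T₀' ×ˢ U₀).image fun p : A × A × A => p.1 + p.2.1 + p.2.2) =
      (((S₁ ×ˢ T₀ ×ˢ U₀).image fun p : A × A × A => p.1 + p.2.1 + p.2.2)).image (· + (-c₀ - b - t)) := by
    rw [eT₀', hT₀t]; exact sumset₃_singleton_shift S₁ U₀ (-c₀ - b) t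
  have hR' : ((S₀ ×ˢ T₀' ×ˢ U₁).image fun p : A × A × A => p.1 + p.2.1 + p.2.2) =
      (((S₀ ×ˢ T₀ ×ˢ U₁).image fun p : A × A × A => p.1 + p.2.1 + p.2.2)).image (· + (-c₀ - b - t)) := by
    rw [eT₀', hT₀t]; exact sumset₃_singleton_shift S₀ U₁ (-c₀ - b) t
  have hQ'e : ((S₀ ×ˢ T₁' ×ˢ U₀).image fun p : A × A × A => p.1 + p.2.1 + p.2.2) =
      (((S₀ ×ˢ T₁ ×ˢ U₀).image fun p : A × A × A => p.1 + p.2.1 + p.2.2)).image (· + (-t - b)) := by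
    rw [eT₁', hT₁b]; exact sumset₃_singleton_shift S₀ U₀ (-t) b
  have hQ'd := shift_of_two_tilings (-c₀ - b - t) hPQ hQR hP'Q' hP'R' hQ'R'
    (by rw [cP', cQ', cR', cT₀', cT₁', hu₀, hu₁, hs]; omega) hP' hR'
    (by rw [cQ', cQ, cT₁', hT₁b, card_singleton])
  -- hence `Q = S₀ + b + U₀` is `c₀`-periodic, of even size `5 (s₁ + 1)`
  have hper := image_add_periodic_of_eq (hQ'd.symm.trans hQ'e)
  have e : -c₀ - b - t - (-t - b) = c₀ := by
    rw [show -c₀ - b - t - (-t - b) = -c₀ by abel]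
    exact (neg_eq_of_add_eq_zero_left h2c)
  rw [e] at hper
  have heven := card_even_of_periodic hper hc₀ h2c
  rw [cQ, hT₁b, card_singleton, hu₀, hs] at heven
  omega

/-- **No P5 triple in dicyclic type.** Dihedral-like `G(A,c₀)` with `c₀ ≠ 0`: there is no TPP triple with coset parts
`(c+1, c | 1,1 | 5,5)` or `(c, c+1 | 1,1 | 5,5)` attaining `3|S||T||U| + 20 = 8|A|` (the `law − 4` shape P5 of
`VertexCountingSubFourShape.lean`). [folklore] -/
theorem no_sub_four_P5_of_c0_ne_zero
    (hρρ : ∀ a b, ρ a * ρ b = ρ (a + b)) (hρτ : ∀ a b, ρ a * τ b = τ (b - a))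
    (hτρ : ∀ a b, τ a * ρ b = τ (a + b)) (hττ : ∀ a b, τ a * τ b = ρ (c₀ + b - a)) (hc₀ : c₀ ≠ 0)
    (hρ : Function.Injective ρ) (hτ : Function.Injective τ) (hne : ∀ a b, ρ a ≠ τ b)
    (hsurj : ∀ g, (∃ a, ρ a = g) ∨ (∃ a, τ a = g)) (h : TripleProductProperty S T U)
    (hs : (univ.filter fun a : A => ρ a ∈ S).card = (univ.filter fun a : A => τ a ∈ S).card + 1 ∨
      (univ.filter fun a : A => τ a ∈ S).card = (univ.filter fun a : A => ρ a ∈ S).card + 1)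
    (ht₀ : (univ.filter fun a : A => ρ a ∈ T).card = 1) (ht₁ : (univ.filter fun a : A => τ a ∈ T).card = 1)
    (hu₀ : (univ.filter fun a : A => ρ a ∈ U).card = 5) (hu₁ : (univ.filter fun a : A => τ a ∈ U).card = 5)
    (hV : 3 * (S.card * T.card * U.card) + 20 = 8 * Fintype.card A) : False := by
  rcases hs with hs | hs
  · exact no_sub_four_P5_core hρρ hρτ hτρ hττ hc₀ hρ hτ hne hsurj h hs ht₀ ht₁ hu₀ hu₁ hV
  · -- swap the parts of `S` by the right translation `S ↦ S·τ0`
    have er : (Equiv.mulRight (1 : G)).toEmbedding = Function.Embedding.refl G := by ext x; simp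
    have hS' := h.map_mulRight (τ 0) 1 1
    simp only [er, Finset.map_refl] at hS'
    have cρ := card_rho_part_mulRight_tau hρρ hρτ hττ (A := A) S
    have cτ := card_tau_part_mulRight_tau hρρ hττ (A := A) S
    exact no_sub_four_P5_core hρρ hρτ hτρ hττ hc₀ hρ hτ hne hsurj hS' (by rw [cρ, cτ, hs]) ht₀ ht₁ hu₀ hu₁
      (by rw [card_map]; exact hV)

/-- **Shapes of the `law − 4` triples when `A/⟨c₀⟩` is not cyclic, sharpened**: only P3 `(c+1, c | 1,1 | 3,3)` (up to
the roles of the three sets). [folklore] -/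
theorem sub_four_shape_of_quot_noncyclic_P3
    (hρρ : ∀ a b, ρ a * ρ b = ρ (a + b)) (hρτ : ∀ a b, ρ a * τ b = τ (b - a))
    (hτρ : ∀ a b, τ a * ρ b = τ (a + b)) (hττ : ∀ a b, τ a * τ b = ρ (c₀ + b - a)) (hc₀ : c₀ ≠ 0)
    (hnq : ¬ ∃ g : A, ∀ x : A, x ∈ AddSubgroup.zmultiples g ∨ x + c₀ ∈ AddSubgroup.zmultiples g)
    (hρ : Function.Injective ρ) (hτ : Function.Injective τ) (hne : ∀ a b, ρ a ≠ τ b)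
    (hsurj : ∀ g, (∃ a, ρ a = g) ∨ (∃ a, τ a = g)) (hmod : Fintype.card A % 3 = 1) (hA : 52 ≤ Fintype.card A)
    (h : TripleProductProperty S T U) (hV : 3 * (S.card * T.card * U.card) + 20 = 8 * Fintype.card A) :
    let s₀ := (univ.filter fun a : A => ρ a ∈ S).card
    let s₁ := (univ.filter fun a : A => τ a ∈ S).card
    let t₀ := (univ.filter fun a : A => ρ a ∈ T).card
    let t₁ := (univ.filter fun a : A => τ a ∈ T).card
    let u₀ := (univ.filter fun a : A => ρ a ∈ U).card
    let u₁ := (univ.filter fun a : A => τ a ∈ U).card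
    (t₀ = t₁ ∧ u₀ = u₁ ∧ t₀ * u₀ = 3 ∧ (s₀ = s₁ + 1 ∨ s₁ = s₀ + 1)) ∨
    (s₀ = s₁ ∧ u₀ = u₁ ∧ s₀ * u₀ = 3 ∧ (t₀ = t₁ + 1 ∨ t₁ = t₀ + 1)) ∨
    (s₀ = s₁ ∧ t₀ = t₁ ∧ s₀ * t₀ = 3 ∧ (u₀ = u₁ + 1 ∨ u₁ = u₀ + 1)) := by
  intro s₀ s₁ t₀ t₁ u₀ u₁
  have hshape := sub_four_shape_of_quot_noncyclic hρρ hρτ hτρ hττ hc₀ hnq hρ hτ hne hsurj hmod hA h hV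
  simp only at hshape
  -- the volume identities for the rotated triples
  have hV_TUS : 3 * (T.card * U.card * S.card) + 20 = 8 * Fintype.card A := by
    rw [show T.card * U.card * S.card = S.card * T.card * U.card by ring]; exact hV
  have hV_UST : 3 * (U.card * S.card * T.card) + 20 = 8 * Fintype.card A := by
    rw [show U.card * S.card * T.card = S.card * T.card * U.card by ring]; exact hV
  have hV_SUT : 3 * (S.card * U.card * T.card) + 20 = 8 * Fintype.card A := by
    rw [show S.card * U.card * T.card = S.card * T.card * U.card by ring]; exact hV
  have hV_TSU : 3 * (T.card * S.card * U.card) + 20 = 8 * Fintype.card A := by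
    rw [show T.card * S.card * U.card = S.card * T.card * U.card by ring]; exact hV
  have hV_UTS : 3 * (U.card * T.card * S.card) + 20 = 8 * Fintype.card A := by
    rw [show U.card * T.card * S.card = S.card * T.card * U.card by ring]; exact hV
  -- `de = 5` is excluded in each role assignment
  have five : ∀ {d e : ℕ}, d * e = 5 → (d = 1 ∧ e = 5) ∨ (d = 5 ∧ e = 1) := by
    intro d e hde
    have hd : d ∣ 5 := ⟨e, hde.symm⟩
    have hd5 : d ≤ 5 := Nat.le_of_dvd (by norm_num) hd
    interval_cases d <;> omega
  rcases hshape with ⟨et, eu, hp, hδ⟩ | ⟨es, eu, hp, hδ⟩ | ⟨es, et, hp, hδ⟩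
  · rcases hp with hp | hp
    · exact Or.inl ⟨et, eu, hp, hδ⟩
    · exfalso
      rcases five hp with ⟨hd, he⟩ | ⟨hd, he⟩
      · -- `T` domino, `U` fives, `S` odd: the P5 theorem for `(S, T, U)`
        exact no_sub_four_P5_of_c0_ne_zero hρρ hρτ hτρ hττ hc₀ hρ hτ hne hsurj h hδ hd (by omega) he (by omega) hV
      · -- `U` domino, `T` fives: roles `(S, U, T)`
        exact no_sub_four_P5_of_c0_ne_zero hρρ hρτ hτρ hττ hc₀ hρ hτ hne hsurj (tpp_reverse h.rotate) hδ he
          (by omega) hd (by omega) hV_SUT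
  · rcases hp with hp | hp
    · exact Or.inr (Or.inl ⟨es, eu, hp, hδ⟩)
    · exfalso
      rcases five hp with ⟨hd, he⟩ | ⟨hd, he⟩
      · -- `S` domino, `U` fives, `T` odd: roles `(T, S, U)`
        exact no_sub_four_P5_of_c0_ne_zero hρρ hρτ hτρ hττ hc₀ hρ hτ hne hsurj (tpp_reverse h.rotate.rotate) hδ hd
          (by omega) he (by omega) hV_TSU
      · -- `U` domino, `S` fives, `T` odd: roles `(T, U, S)`
        exact no_sub_four_P5_of_c0_ne_zero hρρ hρτ hτρ hττ hc₀ hρ hτ hne hsurj h.rotate hδ he (by omega) hd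
          (by omega) hV_TUS
  · rcases hp with hp | hp
    · exact Or.inr (Or.inr ⟨es, et, hp, hδ⟩)
    · exfalso
      rcases five hp with ⟨hd, he⟩ | ⟨hd, he⟩
      · -- `S` domino, `T` fives, `U` odd: roles `(U, S, T)`
        exact no_sub_four_P5_of_c0_ne_zero hρρ hρτ hτρ hττ hc₀ hρ hτ hne hsurj h.rotate.rotate hδ hd (by omega) he
          (by omega) hV_UST
      · -- `T` domino, `S` fives, `U` odd: roles `(U, T, S)`
        exact no_sub_four_P5_of_c0_ne_zero hρρ hρτ hτρ hττ hc₀ hρ hτ hne hsurj (tpp_reverse h) hδ he (by omega) hd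
          (by omega) hV_UTS

/-- **`|A| ≡ 7 (mod 9)`** for a `law − 4` triple of a dicyclic-type group with `A/⟨c₀⟩` not cyclic (`|A| ≥ 52`): the
shape is P3, `|A| = 9c + 7`. [folklore] -/
theorem card_mod_nine_of_sub_four_quot_noncyclic
    (hρρ : ∀ a b, ρ a * ρ b = ρ (a + b)) (hρτ : ∀ a b, ρ a * τ b = τ (b - a))
    (hτρ : ∀ a b, τ a * ρ b = τ (a + b)) (hττ : ∀ a b, τ a * τ b = ρ (c₀ + b - a)) (hc₀ : c₀ ≠ 0)
    (hnq : ¬ ∃ g : A, ∀ x : A, x ∈ AddSubgroup.zmultiples g ∨ x + c₀ ∈ AddSubgroup.zmultiples g)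
    (hρ : Function.Injective ρ) (hτ : Function.Injective τ) (hne : ∀ a b, ρ a ≠ τ b)
    (hsurj : ∀ g, (∃ a, ρ a = g) ∨ (∃ a, τ a = g)) (hmod : Fintype.card A % 3 = 1) (hA : 52 ≤ Fintype.card A)
    (h : TripleProductProperty S T U) (hV : 3 * (S.card * T.card * U.card) + 20 = 8 * Fintype.card A) :
    Fintype.card A % 9 = 7 := by
  have hshape := sub_four_shape_of_quot_noncyclic_P3 hρρ hρτ hτρ hττ hc₀ hnq hρ hτ hne hsurj hmod hA h hV
  simp only at hshape
  set s₀ := (univ.filter fun a : A => ρ a ∈ S).card with hs₀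
  set s₁ := (univ.filter fun a : A => τ a ∈ S).card with hs₁
  set t₀ := (univ.filter fun a : A => ρ a ∈ T).card with ht₀
  set t₁ := (univ.filter fun a : A => τ a ∈ T).card with ht₁
  set u₀ := (univ.filter fun a : A => ρ a ∈ U).card with hu₀
  set u₁ := (univ.filter fun a : A => τ a ∈ U).card with hu₁
  have cS : S.card = s₀ + s₁ := card_eq_parts' hρ hτ hne hsurj S
  have cT : T.card = t₀ + t₁ := card_eq_parts' hρ hτ hne hsurj T
  have cU : U.card = u₀ + u₁ := card_eq_parts' hρ hτ hne hsurj U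
  have h20 := hV
  rw [cS, cT, cU] at h20
  rcases hshape with ⟨et, eu, hp, -⟩ | ⟨es, eu, hp, -⟩ | ⟨es, et, hp, -⟩
  · rw [← et, ← eu] at h20
    have e4 : (s₀ + s₁) * (t₀ + t₀) * (u₀ + u₀) = 4 * (t₀ * u₀) * (s₀ + s₁) := by ring
    rw [e4, hp] at h20; omega
  · rw [← es, ← eu] at h20
    have e4 : (s₀ + s₀) * (t₀ + t₁) * (u₀ + u₀) = 4 * (s₀ * u₀) * (t₀ + t₁) := by ring
    rw [e4, hp] at h20; omega
  · rw [← es, ← et] at h20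
    have e4 : (s₀ + s₀) * (t₀ + t₀) * (u₀ + u₁) = 4 * (s₀ * t₀) * (u₀ + u₁) := by ring
    rw [e4, hp] at h20; omega

/-- **Dicyclic type with `A/⟨c₀⟩` not cyclic, sharpened** (`|A| ≡ 1 (mod 3)`, `|A| ≥ 52`): every TPP triple has
`3|S||T||U| + 32 ≤ 8|A|`, or `3|S||T||U| + 20 = 8|A|` and then `|A| ≡ 7 (mod 9)`. [folklore] -/
theorem tpp_volume_dicyclic_quot_noncyclic'
    (hρρ : ∀ a b, ρ a * ρ b = ρ (a + b)) (hρτ : ∀ a b, ρ a * τ b = τ (b - a))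
    (hτρ : ∀ a b, τ a * ρ b = τ (a + b)) (hττ : ∀ a b, τ a * τ b = ρ (c₀ + b - a)) (hc₀ : c₀ ≠ 0)
    (hnq : ¬ ∃ g : A, ∀ x : A, x ∈ AddSubgroup.zmultiples g ∨ x + c₀ ∈ AddSubgroup.zmultiples g)
    (hρ : Function.Injective ρ) (hτ : Function.Injective τ) (hne : ∀ a b, ρ a ≠ τ b)
    (hsurj : ∀ g, (∃ a, ρ a = g) ∨ (∃ a, τ a = g)) (hmod : Fintype.card A % 3 = 1) (hA : 52 ≤ Fintype.card A)
    (h : TripleProductProperty S T U) :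
    3 * (S.card * T.card * U.card) + 32 ≤ 8 * Fintype.card A ∨
      (3 * (S.card * T.card * U.card) + 20 = 8 * Fintype.card A ∧ Fintype.card A % 9 = 7) := by
  rcases tpp_volume_dicyclic_quot_noncyclic hρρ hρτ hτρ hττ hc₀ hnq hρ hτ hne hsurj hmod hA h with h32 | ⟨h20, -⟩
  · exact Or.inl h32
  · exact Or.inr ⟨h20, card_mod_nine_of_sub_four_quot_noncyclic hρρ hρτ hτρ hττ hc₀ hnq hρ hτ hne hsurj hmod hA h h20⟩

end DihedralLike

section C2Q

variable {m : ℕ} [NeZero m]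

/-- **`m ≡ 4 (mod 6)`, `m ≥ 13`: every TPP triple of `C₂ × Q_{4m}` has volume `≤ (32m − 32)/3`, or exactly
`(32m − 20)/3` and then `m ≡ 4 (mod 9)`.** [folklore] -/
theorem c2_quaternion_volume_mod_six_four' (hmod : m % 6 = 4) (hm : 13 ≤ m)
    {S T U : Finset (Multiplicative (ZMod 2) × QuaternionGroup m)} (h : TripleProductProperty S T U) :
    3 * (S.card * T.card * U.card) + 32 ≤ 32 * m ∨ (3 * (S.card * T.card * U.card) + 20 = 32 * m ∧ m % 9 = 4) := by
  haveI : NeZero (2 * m) := ⟨by omega⟩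
  obtain ⟨hc₀, hnq⟩ := z2_z2m_quot_half_noncyclic (m := m) ⟨m / 2, by omega⟩
  refine c2_quaternion_presentation (m := m) fun ρ τ c₀ hρρ hρτ hτρ hττ hρ hτ hne hsurj hc => ?_
  subst hc
  have hcard : Fintype.card (ZMod 2 × ZMod (2 * m)) = 4 * m := by
    rw [Fintype.card_prod, ZMod.card, ZMod.card]; ring
  have key := tpp_volume_dicyclic_quot_noncyclic' hρρ hρτ hτρ hττ hc₀ hnq hρ hτ hne hsurj (by rw [hcard]; omega)
    (by rw [hcard]; omega) h
  rw [hcard] at key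
  omega

/-- **`β(C₂ × Q_{4m}) = 16⌊2m/3⌋ = (32m − 32)/3` exactly for `m ≡ 4 (mod 6)`, `m ≥ 13`, `m ≢ 4 (mod 9)`** — i.e. for
`m ≡ 10, 16 (mod 18)`: `m = 16, 28, 34, 46, 52, 64, 70, 82, 88, 100, …`. [folklore] -/
theorem c2_quaternion_law_mod_six_four' (hmod : m % 6 = 4) (hm : 13 ≤ m) (h9 : m % 9 ≠ 4) :
    (∀ S T U : Finset (Multiplicative (ZMod 2) × QuaternionGroup m), TripleProductProperty S T U →
        S.card * T.card * U.card ≤ 16 * (2 * m / 3)) ∧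
    ∃ S T U : Finset (Multiplicative (ZMod 2) × QuaternionGroup m), TripleProductProperty S T U ∧
      S.card * T.card * U.card = 16 * (2 * m / 3) := by
  refine ⟨fun S T U h => ?_, c2_quaternion_volume_ge (by omega)⟩
  rcases c2_quaternion_volume_mod_six_four' hmod hm h with h32 | ⟨-, hres⟩ <;> omega

end C2Q

end Summit.MatrixMultiplication.OmegaCensus
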